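import Summits.ResolutionOfSingularities.ResolutionOfSingularities.Theorems.HomologicalConductorNoZenoRFirstKindChartSection
import Literature.AlgebraicGeometry.Resolution.ComponentGluing
import Mathlib.RingTheory.Artinian.Module
import HarnessLib

/-!
# Crux `NoZenoR` (stmt-ResolutionOfSingularities-19943) — a morphism that sends an integral exceptional curve `E_η`
# into an AFFINE open is CONSTANT on `E_η` (step [G4] of the Castelnuovo-free road to Lipman (27.3)/(27.1))

Route `ResolutionOfSingularities/HomologicalConductor` (cell decomp-res, hand leafhand-res-homologicalconduct-24 g0).
OURS: AI-written proof over Mathlib and tree lemmas, weaker than expert review; nothing here is a statement of the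
manuscript under review (Hironaka 2017).  SUPPORT level, counted 0.  Def-free, fact-free.

For `π : X → Spec S` proper over a Noetherian local ring and `η ∈ excCurvePoints π`, the integral curve `E_η = cl{η}`
(with its reduced structure `V(𝓘_η)`) has a ring of global sections which is a DOMAIN of FINITE LENGTH over `S`
(`h⁰(𝓘_η) < ∞`, tree `h0_pow_primeDivisorIdeal_ne_top`), hence a FIELD (Artinian domain), so `Spec Γ(E_η, 𝒪)` is a
point; a morphism `E_η → W` to an affine scheme factors through `Spec Γ(E_η, 𝒪)` (`Γ ⊣ Spec`), hence is constant:

* `subsingleton_primeSpectrum_of_isField` — a field has one prime ideal;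
* `isField_sections_subscheme_primeDivisorIdeal` — `Γ(V(𝓘_η), 𝒪)` is a field;
* `apply_eq_of_isAffine` — a morphism from a scheme `E` whose ring of global sections has ONE prime to an affine
  scheme is constant on points;
* **`apply_eq_apply_of_image_closure_subset`** — for any morphism `σ : X → V` and an affine open `W ⊆ V` with
  `σ(cl{η}) ⊆ W`: `σ x = σ η` for every `x ∈ cl{η}`; in particular (`isClosed_singleton_apply_of_image_closure_subset`)
  `σ η` is a CLOSED point when `σ` is a closed map.

Use (memo MEMO-19943-hand24g0-M0-ROAD.md): with `σ : X → Bl_𝔪 Spec S` the domination of a desingularization of a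
non-regular rational `S` and `E_η` of the first kind, `cl{η}` lies in one chart `X_c` (`…FirstKindChartSection`), so —
once [G2]/[G3] place `σ(cl{η})` inside the affine chart `D₊(ct)` — `σ(η)` is a closed point of the quadratic transform.
No crux or summit statement is proved here.
-/

noncomputable section

-- single-problem summit: the doubled namespace component `ResolutionOfSingularities` is forced
set_option linter.dupNamespace false

open CategoryTheory CategoryTheory.Limits AlgebraicGeometry TopologicalSpace IsLocalRing
open Literature.AlgebraicGeometry Literature.AlgebraicGeometry.Resolution Literature.AlgebraicGeometry.Morphisms

namespace Summit.ResolutionOfSingularities.ResolutionOfSingularities.Theorems.NoZeno.FirstKind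

/-! ## §1 Algebra: fields have one prime; Artinian domains are fields -/

/-- A commutative ring which is a field has exactly one prime ideal (`⊥`). [folklore] -/
theorem subsingleton_primeSpectrum_of_isField {A : Type*} [CommRing A] (hA : IsField A) :
    Subsingleton (PrimeSpectrum A) := by
  refine ⟨fun p q => PrimeSpectrum.ext ?_⟩
  have hbot : ∀ r : PrimeSpectrum A, r.asIdeal = ⊥ := by
    intro r
    refine le_bot_iff.mp fun x hx => ?_
    by_contra hx0
    obtain ⟨y, hy⟩ := hA.mul_inv_cancel hx0
    exact r.isPrime.ne_top (Ideal.eq_top_of_isUnit_mem _ hx (isUnit_iff_exists_inv.mpr ⟨y, hy⟩))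
  rw [hbot p, hbot q]

/-! ## §2 The ring of global sections of an integral exceptional curve is a field -/

section Curve

variable {S : Type} [CommRing S] [IsNoetherianRing S] [IsLocalRing S]
  {X : Scheme.{0}} (π : X ⟶ Spec (.of S)) [IsProper π]

/-- `V(𝓘_η)` (the reduced structure on `cl{η}`) is an integral scheme. [folklore] -/
theorem isIntegral_subscheme_primeDivisorIdeal (η : X) : IsIntegral (primeDivisorIdeal η).subscheme :=
  ComponentGluing.isIntegral_subscheme_vanishingIdeal _ isIrreducible_singleton.closure

/-- **`Γ(E_η, 𝒪_{E_η})` is a field** for an integral exceptional curve `E_η = V(𝓘_η)` of a proper `π : X → Spec S`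
over a Noetherian local ring: it is a domain (`E_η` integral) of finite length over `S` (`h⁰(𝓘_η) < ∞`), hence an
Artinian domain. [cite: Lipman1969, Section 12, Remark 2 a) (p. 221)] -/
theorem isField_sections_subscheme_primeDivisorIdeal {η : X} (hη : η ∈ excCurvePoints π) :
    IsField Γ((primeDivisorIdeal η).subscheme, ⊤) := by
  haveI := isIntegral_subscheme_primeDivisorIdeal (X := X) η
  set E := (primeDivisorIdeal η).subscheme with hE
  -- finite length over `S`
  have hfin : Module.length S (Sections ((primeDivisorIdeal η).subschemeι ≫ π) ⊤) ≠ ⊤ := by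
    have h := h0_pow_primeDivisorIdeal_ne_top π hη one_ne_zero
    rwa [pow_one, h0_eq] at h
  have hfl : IsFiniteLength S (Sections ((primeDivisorIdeal η).subschemeι ≫ π) ⊤) :=
    Module.length_ne_top_iff.mp hfin
  have hart : IsArtinian S (Sections ((primeDivisorIdeal η).subschemeι ≫ π) ⊤) :=
    ((isFiniteLength_iff_isNoetherian_isArtinian).mp hfl).2
  haveI : IsArtinianRing (Sections ((primeDivisorIdeal η).subschemeι ≫ π) ⊤) :=
    isArtinian_of_tower S hart
  haveI : IsDomain (Sections ((primeDivisorIdeal η).subschemeι ≫ π) ⊤) :=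
    inferInstanceAs (IsDomain Γ(E, ⊤))
  exact IsArtinianRing.isField_of_isDomain (Sections ((primeDivisorIdeal η).subschemeι ≫ π) ⊤)

end Curve

/-! ## §3 Morphisms to affine schemes are constant on such curves -/

/-- **A morphism to an affine scheme from a scheme whose ring of global sections has one prime is constant**:
`f = toSpecΓ ≫ Spec(f^*) ≫ (iso)` (`Γ ⊣ Spec`), and `Spec Γ(E, 𝒪_E)` is a single point. [folklore] -/
theorem apply_eq_of_isAffine {E W : Scheme.{0}} [IsAffine W] (h : Subsingleton (PrimeSpectrum Γ(E, ⊤)))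
    (f : E ⟶ W) (e₁ e₂ : E) : f.base e₁ = f.base e₂ := by
  have hnat := Scheme.toSpecΓ_naturality f
  have h1 : (f ≫ W.toSpecΓ).base e₁ = (f ≫ W.toSpecΓ).base e₂ := by
    rw [hnat, Scheme.Hom.comp_apply, Scheme.Hom.comp_apply]
    exact congrArg _ (Subsingleton.elim (α := PrimeSpectrum Γ(E, ⊤)) _ _)
  rw [Scheme.Hom.comp_apply, Scheme.Hom.comp_apply] at h1
  exact W.toSpecΓ.isOpenEmbedding.injective h1

section Constant

variable {S : Type} [CommRing S] [IsNoetherianRing S] [IsLocalRing S]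
  {X : Scheme.{0}} (π : X ⟶ Spec (.of S)) [IsProper π]

/-- **MAIN — a morphism sending an integral exceptional curve into an affine open is constant on it.**  For
`π : X → Spec S` proper over a Noetherian local ring, `η ∈ excCurvePoints π`, any morphism `σ : X → V` and any affine
open `W ⊆ V` with `σ(cl{η}) ⊆ W`: `σ x = σ η` for all `x ∈ cl{η}`. [cite: Lipman1969, Section 12 (p. 220)] -/
theorem apply_eq_apply_of_image_closure_subset {η : X} (hη : η ∈ excCurvePoints π) {V : Scheme.{0}}
    (σ : X ⟶ V) (W : V.Opens) (hW : IsAffineOpen W) (hsub : σ.base '' closure {η} ⊆ (W : Set V))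
    {x : X} (hx : x ∈ closure ({η} : Set X)) : σ.base x = σ.base η := by
  haveI := isIntegral_subscheme_primeDivisorIdeal (X := X) η
  haveI : IsAffine W := hW
  set ι := (primeDivisorIdeal η).subschemeι with hι
  have hrange : Set.range ι.base = closure {η} := by
    rw [hι, primeDivisorIdeal]
    exact ComponentGluing.range_subschemeι_vanishingIdeal _
  -- lift `ι ≫ σ` through the open immersion `W ↪ V`
  have hsub' : Set.range (ι ≫ σ).base ⊆ Set.range W.ι.base := by
    rintro _ ⟨e, rfl⟩
    rw [Scheme.Opens.range_ι]
    exact hsub ⟨ι.base e, hrange ▸ ⟨e, rfl⟩, (Scheme.Hom.comp_apply ι σ e).symm⟩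
  let φ : (primeDivisorIdeal η).subscheme ⟶ W := IsOpenImmersion.lift W.ι (ι ≫ σ) hsub'
  have hφ : φ ≫ W.ι = ι ≫ σ := IsOpenImmersion.lift_fac W.ι (ι ≫ σ) hsub'
  -- points of `cl{η}` come from `E`
  obtain ⟨e, rfl⟩ : x ∈ Set.range ι.base := hrange ▸ hx
  obtain ⟨e₀, he₀⟩ : η ∈ Set.range ι.base := hrange ▸ subset_closure rfl
  have hconst := apply_eq_of_isAffine
    (subsingleton_primeSpectrum_of_isField (isField_sections_subscheme_primeDivisorIdeal π hη)) φ e e₀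
  calc σ.base (ι.base e) = (ι ≫ σ).base e := (Scheme.Hom.comp_apply ι σ e).symm
    _ = (φ ≫ W.ι).base e := by rw [hφ]
    _ = W.ι.base (φ.base e) := Scheme.Hom.comp_apply _ _ _
    _ = W.ι.base (φ.base e₀) := by rw [hconst]
    _ = (φ ≫ W.ι).base e₀ := (Scheme.Hom.comp_apply _ _ _).symm
    _ = (ι ≫ σ).base e₀ := by rw [hφ]
    _ = σ.base (ι.base e₀) := Scheme.Hom.comp_apply ι σ e₀
    _ = σ.base η := congrArg σ.base he₀

/-- Hence, for `σ` a CLOSED map (e.g. proper), `σ η` is a closed point: `σ(cl{η}) = {σ η}` is closed.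
[cite: Lipman1969, Section 12 (p. 220)] -/
theorem isClosed_singleton_apply_of_image_closure_subset {η : X} (hη : η ∈ excCurvePoints π) {V : Scheme.{0}}
    (σ : X ⟶ V) (hσ : IsClosedMap σ.base) (W : V.Opens) (hW : IsAffineOpen W)
    (hsub : σ.base '' closure {η} ⊆ (W : Set V)) : IsClosed ({σ.base η} : Set V) := by
  have himg : σ.base '' closure {η} = {σ.base η} := by
    refine Set.eq_singleton_iff_unique_mem.mpr ⟨⟨η, subset_closure rfl, rfl⟩, ?_⟩
    rintro _ ⟨x, hx, rfl⟩
    exact apply_eq_apply_of_image_closure_subset π hη σ W hW hsub hx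
  rw [← himg]
  exact hσ _ isClosed_closure

end Constant

end Summit.ResolutionOfSingularities.ResolutionOfSingularities.Theorems.NoZeno.FirstKind

end
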